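import Summits.QuantumFields.YangMills.Theorems.PoincareLipschitzFlatRieszLogSourced
import HarnessLib

/-!
# Line «poincare_lipschitz» on crux `HistoryTailL` (stmt-QuantumFields-19936), route crux `BlockLipschitzL` (stmt-QuantumFields-23533), K2 organ M-COUL —
# «BLOCK-MASS step 3», FILE 2: THE GREEN-FREE LOCAL GRADIENT BOUND FOR THE BLOCK-MASS OPERATOR IN THE COMPLEX `opD` LETTERS OF ✓`B4Green244`
# (`opD n a m² = −Δ^η + m² + a·Q*Q`, `n` = block side): `opD h = ∂^{η*}f` on `Q_{2n+4}(x)`, `‖f‖ ≤ F` there, `‖h‖ ≤ H` on `Q_{3n+6}(x)` ⟹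
# `‖n(h(x+e_μ) − h(x))‖ ≤ C_d·(log₂(n+1)+1)·(F + (1+m²+a)·H)` — any region, three blocks in; no Green's function, no volume

Cell `ym3-torus` (YM ladder rung R3 = continuum SU(2) Yang–Mills on the three-torus — a RUNG, NOT the Clay problem: not d = 4, not infinite volume, not a
mass gap); width seat `ym3-torus-px7` gen 5 (LEAD ym-ust-19936-w1 g8 WORD 4 «(B) GREEN-FREE local form, region-agnostic — the shape M-COUL-G's per-level row will
instantiate on reading sets» and ruling (R1) 03:44:46Z «px7 owns the SEQUEL BLOCK-MASS step 3 = REGION∕WEIGHT FORM»; step 2 = ★w5-19936 g11's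
✓`PoincareLipschitzFlatBlockMassRieszLog`).  THEOREMS ONLY (def-free) over FILE 1 ✓`PoincareLipschitzFlatRieszLogSourced` (the real `ℤ^d` analysis); letters of the
zero-field lineage (`B4Green244.opD∕negLap∕blockAvg∕finePt∕coarse∕e`, `(∂^{η*}f)(y) = Σ_ν n(f(y−e_ν,ν) − f(y,ν))`); `--supports stmt-QuantumFields-19936`.  Nothing here
proves hLow, hG, the per-bond charts, `hStab`, F6, a stub, `BlockLipschitzL`, `HistoryTailL` or a summit statement.

WHY.  The organ of record `hG` (M-COUL-G per level; w2 g11's typed face 6de5ceb5, card v1.35) reads the block-mass gradient bound on READING SETS, not on the whole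
lattice: the equation `(−Δ^η + m² + a_kQ*Q)h = ∂^{η*}f` and the data bounds are available on a region, the conclusion is wanted at points a few blocks inside it.
Step 2's headline (★w5's `blockMass_gradient_le_log`) is global (`h = G_k(0)∂^{η*}f` on `ℤ^{d+1}`); its Green-free brick `abs_fdiff_le_log_of_dvg_of_sup` is for
`−Δu = ∂*G`.  This file is the Green-free form FOR THE BLOCK-MASS OPERATOR ITSELF, with every hypothesis on boxes around `x`: the mass-plus-averaging term is
carried as the zeroth-order source of FILE 1's ★★`exists_abs_fdiff_le_log_sourced` (via FILE 1's real theorem ★★`exists_nfdiff_le_log_blockMass`), real and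
imaginary parts separately.

* `e_eq_unitVec`, `unitVec_eq_single` — the sites `Fin (d+1) → ℤ` ARE `B4Eq19LatticeOperators.Zd (d+1)` and `B4Green244.e μ = unitVec μ = Pi.single μ 1` by `rfl`.
* `re_opD`, `im_opD`, `re_adjDiv`, `im_adjDiv` — the dictionary `re∕im (opD n a m² φ) = n²·lop 0 (re∕im φ) + m²·(re∕im φ) + a·(block mean)`,
  `re∕im (∂^{η*}f) = n·dvg (re∕im f)`.
* ★★ `exists_norm_nfdiff_le_log_opD` — the title.
HONEST.  Flat (`A = 0`), scalar; the `log` is the Calderón–Zygmund logarithm below the block scale; nothing covariant ∕ multiscale; YM₃ on T³ is rung R3, not the Clay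
problem.  [folklore] ([Balaban1983RegularityDecay] (1.6) p.572, Lemma 2.2 (2.17) p.578, (2.44) p.584; [Giaquinta1984] Ch. III §3 Thm 3.1 p.84).
-/

set_option autoImplicit false

noncomputable section

open scoped BigOperators
open Finset

namespace Summit.QuantumFields.YangMills.Theorems.PoincareLipschitzFlatBlockMassLocalOpD

open Literature.MathematicalPhysics.QuantumFieldTheory.Balaban1983to89
open B4Eq19LatticeOperators B4Eq19LatticeBoxMeans
open Summit.QuantumFields.YangMills.Theorems.PoincareLipschitzFlatRieszLogSourced (exists_nfdiff_le_log_blockMass)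

/-! ## The dictionary and the local theorem in the `opD` letters -/

section LocalComplex

variable {d : ℕ}

open B4Green244 (coarse finePt opD negLap blockAvg)

/-- `B4Green244.e μ = unitVec μ` (`= Pi.single μ 1`). [folklore] -/
theorem e_eq_unitVec (μ : Fin d) : B4Green244.e μ = unitVec μ := rfl

/-- `unitVec μ = Pi.single μ 1`. [folklore] -/
theorem unitVec_eq_single (μ : Fin d) : (unitVec μ : Zd d) = Pi.single μ 1 := rfl

/-- REAL PART OF THE BLOCK-MASS OPERATOR: `re (opD n a m² φ)(y) = n²·(−Δ re φ)(y) + m²·re φ(y) + a·(block mean of re φ)(y)`. [folklore]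
[cite: Balaban1983RegularityDecay, (1.6) p.572, (2.44) p.584] -/
theorem re_opD (n : ℕ) (a m2 : ℝ) (φ : Zd d → ℂ) (y : Zd d) :
    (opD n a m2 φ y).re = (n : ℝ) ^ 2 * lop 0 (fun z => (φ z).re) y + m2 * (φ y).re +
      a * (((n : ℝ) ^ d)⁻¹ * ∑ j : Fin d → Fin n, (φ (finePt n (coarse n y) j)).re) := by
  have e1 : (n : ℂ) ^ 2 = (((n : ℝ) ^ 2 : ℝ) : ℂ) := by push_cast; ring
  have e2 : ((n : ℂ) ^ d)⁻¹ = ((((n : ℝ) ^ d)⁻¹ : ℝ) : ℂ) := by push_cast; ring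
  have e3 : ∀ z : ℂ, ((2 : ℂ) * z).re = 2 * z.re := fun z => by simp
  simp only [opD, negLap, blockAvg, e1, e2, Complex.add_re, Complex.re_ofReal_mul, Complex.re_sum, Complex.sub_re, e3,
    lop_apply, zero_mul, add_zero, e_eq_unitVec]

/-- IMAGINARY PART OF THE BLOCK-MASS OPERATOR. [folklore] [cite: Balaban1983RegularityDecay, (1.6) p.572, (2.44) p.584] -/
theorem im_opD (n : ℕ) (a m2 : ℝ) (φ : Zd d → ℂ) (y : Zd d) :
    (opD n a m2 φ y).im = (n : ℝ) ^ 2 * lop 0 (fun z => (φ z).im) y + m2 * (φ y).im +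
      a * (((n : ℝ) ^ d)⁻¹ * ∑ j : Fin d → Fin n, (φ (finePt n (coarse n y) j)).im) := by
  have e1 : (n : ℂ) ^ 2 = (((n : ℝ) ^ 2 : ℝ) : ℂ) := by push_cast; ring
  have e2 : ((n : ℂ) ^ d)⁻¹ = ((((n : ℝ) ^ d)⁻¹ : ℝ) : ℂ) := by push_cast; ring
  have e3 : ∀ z : ℂ, ((2 : ℂ) * z).im = 2 * z.im := fun z => by simp
  simp only [opD, negLap, blockAvg, e1, e2, Complex.add_im, Complex.im_ofReal_mul, Complex.im_sum, Complex.sub_im, e3,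
    lop_apply, zero_mul, add_zero, e_eq_unitVec]

/-- REAL PART OF THE ADJOINT DIFFERENCE: `re (∂^{η*}f)(y) = n·(∂*(re f))(y)` (`dvg` letters). [folklore] -/
theorem re_adjDiv (n : ℕ) (f : Zd d → Fin d → ℂ) (y : Zd d) :
    (∑ ν, (n : ℂ) * (f (y - Pi.single ν 1) ν - f y ν)).re = (n : ℝ) * dvg (fun z ν => (f z ν).re) y := by
  have e1 : (n : ℂ) = (((n : ℝ)) : ℂ) := by push_cast; ring
  simp only [e1, Complex.re_sum, Complex.re_ofReal_mul, Complex.sub_re, dvg_apply, unitVec_eq_single, Finset.mul_sum]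

/-- IMAGINARY PART OF THE ADJOINT DIFFERENCE. [folklore] -/
theorem im_adjDiv (n : ℕ) (f : Zd d → Fin d → ℂ) (y : Zd d) :
    (∑ ν, (n : ℂ) * (f (y - Pi.single ν 1) ν - f y ν)).im = (n : ℝ) * dvg (fun z ν => (f z ν).im) y := by
  have e1 : (n : ℂ) = (((n : ℝ)) : ℂ) := by push_cast; ring
  simp only [e1, Complex.im_sum, Complex.im_ofReal_mul, Complex.sub_im, dvg_apply, unitVec_eq_single, Finset.mul_sum]

/-- ★★ **(B) THE GREEN-FREE LOCAL FORM IN THE `opD` LETTERS** (`opD n a m² = −Δ^η + m² + aQ*Q` of ✓`B4Green244`, `n` = block side,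
complex fields): `d ≥ 1`; there is `C = C_d > 0` such that for `n ≥ 1`, `a, m² ≥ 0`, every `h`, bond data `f`, site `x` with
`opD n a m² h = ∂^{η*}f` on `Q_{2n+4}(x)` (`(∂^{η*}f)(y) = Σ_ν n(f(y−e_ν,ν) − f(y,ν))`), `‖f‖ ≤ F` on `Q_{2n+4}(x)`, `‖h‖ ≤ H` on `Q_{3n+6}(x)`:
`‖n(h(x+e_μ) − h(x))‖ ≤ C·(log₂(n+1)+1)·(F + (1 + m² + a)·H)` — any region, three blocks in; NO Green's function, NO `log`(volume).
[folklore] [cite: Balaban1983RegularityDecay, (1.6) p.572, Lemma 2.2 (2.17) p.578; Giaquinta1984, Ch. III §3 Thm 3.1 p.84] -/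
theorem exists_norm_nfdiff_le_log_opD (hd : 1 ≤ d) : ∃ C : ℝ, 0 < C ∧
    ∀ (n : ℕ) (a m2 : ℝ) (h : Zd d → ℂ) (f : Zd d → Fin d → ℂ) (x : Zd d) (F H : ℝ),
      1 ≤ n → 0 ≤ a → 0 ≤ m2 → 0 ≤ F → 0 ≤ H →
      (∀ y ∈ box x (2 * (n : ℤ) + 4), opD n a m2 h y = ∑ ν, (n : ℂ) * (f (y - Pi.single ν 1) ν - f y ν)) →
      (∀ y ∈ box x (2 * (n : ℤ) + 4), ∀ ν, ‖f y ν‖ ≤ F) → (∀ y ∈ box x (3 * (n : ℤ) + 6), ‖h y‖ ≤ H) →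
      ∀ μ : Fin d, ‖(n : ℂ) * (h (x + Pi.single μ 1) - h x)‖ ≤ C * (((Nat.log 2 (n + 1) : ℝ) + 1) * (F + (1 + m2 + a) * H)) := by
  obtain ⟨C, hC, hB⟩ := exists_nfdiff_le_log_blockMass hd
  refine ⟨2 * C, by positivity, ?_⟩
  intro n a m2 h f x F H hn ha hm2 hF hH hEq hf hh μ
  -- real and imaginary parts
  have hre := hB n a m2 (fun z => (h z).re) (fun z ν => (f z ν).re) x F H hn ha hm2 hF hH
    (fun y hy => by rw [← re_opD, ← re_adjDiv, hEq y hy])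
    (fun y hy ν => (Complex.abs_re_le_norm _).trans (hf y hy ν)) (fun y hy => (Complex.abs_re_le_norm _).trans (hh y hy)) μ
  have him := hB n a m2 (fun z => (h z).im) (fun z ν => (f z ν).im) x F H hn ha hm2 hF hH
    (fun y hy => by rw [← im_opD, ← im_adjDiv, hEq y hy])
    (fun y hy ν => (Complex.abs_im_le_norm _).trans (hf y hy ν)) (fun y hy => (Complex.abs_im_le_norm _).trans (hh y hy)) μ
  rw [fdiff_apply, unitVec_eq_single] at hre him
  have hn0 : (0 : ℝ) ≤ n := Nat.cast_nonneg n
  calc ‖(n : ℂ) * (h (x + Pi.single μ 1) - h x)‖ = (n : ℝ) * ‖h (x + Pi.single μ 1) - h x‖ := by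
        rw [norm_mul, Complex.norm_natCast]
    _ ≤ (n : ℝ) * (|(h (x + Pi.single μ 1) - h x).re| + |(h (x + Pi.single μ 1) - h x).im|) :=
        mul_le_mul_of_nonneg_left (Complex.norm_le_abs_re_add_abs_im _) hn0
    _ = (n : ℝ) * |(h (x + Pi.single μ 1)).re - (h x).re| + (n : ℝ) * |(h (x + Pi.single μ 1)).im - (h x).im| := by
        rw [Complex.sub_re, Complex.sub_im, mul_add]
    _ ≤ C * (((Nat.log 2 (n + 1) : ℝ) + 1) * (F + (1 + m2 + a) * H)) + C * (((Nat.log 2 (n + 1) : ℝ) + 1) * (F + (1 + m2 + a) * H)) :=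
        add_le_add hre him
    _ = 2 * C * (((Nat.log 2 (n + 1) : ℝ) + 1) * (F + (1 + m2 + a) * H)) := by ring

end LocalComplex

end Summit.QuantumFields.YangMills.Theorems.PoincareLipschitzFlatBlockMassLocalOpD

end
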